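import Summits.QuantumFields.GaugeBoot.DiagonalRPTorusTubeRings
import HarnessLib

/-!
# The back plaquettes through a transverse square: generic layer and the ODD torus
(gauge-boot, L3 sequel, odd case 1/4)

HONEST FRAMING (cell `pub-gaugeboot`, page 1 of every file): the venture produces certified bounds
on lattice expectations at stated coupling, gauge group, dimension and torus size; NOT a mass gap,
NOT a continuum limit, NOT a string tension; NOT Yang–Mills-summit-bearing (barriers
`FixedCouplingUltralocality`, `PerturbativeInvisibility`). This module is bookkeeping for a
structural NEGATIVE result (`DiagonalRPTorusClosedHalfNegativeHighDim`: closed-half diagonal RP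
fails on every ODD torus `(ℤ/L)^d`, `d ≥ 4`, `L ≥ 3`, at small coupling); it discharges nothing
by itself.

## Content (torus `(ℤ/L)^d`, mirror `y_i = y_j`, `i < j < k < l`, half `δ.val < h`)

* `mem_restPlaqs_of_verts` — a plaquette with one vertex outside the half and one vertex whose
  mirror layer is outside the half is a rest plaquette;
* **`cover_low_gen`** / **`cover_high_gen`** — the cover lemmas of `DiagonalRPTorusTubeRings`
  for a GENERIC top layer `t` (`t`, `t - 1` in the half, `t ≠ 0`): the rest plaquettes through an
  edge of a transverse square on the layer `t` (resp. `-t`) are among two ring faces;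
* the ODD TORUS `L = 2c + 1`, closed half `h = c + 1`, top layer `t = c`, mirror image `-c = c+1`
  (ADJACENT layers — the tube between them has length one): cast facts and the ring membership
  lemmas `ring_low_i_mem_odd`, `ring_low_j_mem_odd`, `ring_high_i_mem_odd`, `ring_high_j_mem_odd`.

Elementary bookkeeping; no named fact.
-/

open Finset Function

namespace Summit.QuantumFields.GaugeBoot

open Literature.MathematicalPhysics.QuantumFieldTheory

namespace DiagRPTube

variable {d L : ℕ}

/-! ## A two-vertex rest test -/

section Rest

variable {i j : Fin d} {h : ℕ} [NeZero L]

/-- **Two vertices put `q` in the rest**: one not in the half, one whose mirror layer is not in the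
half. -/
theorem mem_restPlaqs_of_verts {q : Plaquette d L} (a b : Fin 4)
    (h1 : ¬ (lay i j (vert q a)).val < h) (h2 : ¬ (-lay i j (vert q b)).val < h) :
    q ∈ restPlaqs i j h := by
  rw [mem_restPlaqs, mem_innerPlaqs, mem_swapPlaqs, mem_innerPlaqs, not_and, not_and]
  refine ⟨fun hin _ => h1 (hin a), fun hin _ => h2 ?_⟩
  obtain ⟨b', hb⟩ := exists_vert_plaqSwap i j (plaqSwap i j q) b
  rw [plaqSwap_plaqSwap] at hb
  have e : lay i j (vert (plaqSwap i j q) b') = -lay i j (vert q b) := by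
    rw [hb, lay_siteDiagSwap, neg_neg]
  have := hin b'
  unfold InHalf at this
  rwa [e] at this

end Rest

/-! ## Generic cover lemmas -/

section Cover

variable {i j k l : Fin d} (hij : i < j) (hjk : j < k) (hkl : k < l) {h : ℕ} [NeZero L]

include hij hjk hkl

/-- **Generic low cover lemma.** For a transverse square `sq k l x` on a layer `δ(x) = t` with
`t`, `t - 1` in the half `δ.val < h` and `t ≠ 0`, the rest plaquettes containing its edge `a`
are among the ring faces `ring i x a` and `ring j (x - e_j) a`. -/
theorem cover_low_gen {t : ZMod L} (ht1 : t.val < h) (ht2 : (t - 1).val < h) (ht0 : t ≠ 0)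
    {x : Site d L} (hx : lay i j x = t) {a : Fin 4}
    {q : Plaquette d L} (hq : q ∈ restPlaqs i j h) (hqa : HasLink q (link (sq k l hkl x) a)) :
    q = ring (hij.trans hjk) (hij.trans (hjk.trans hkl)) x a ∨
      q = ring hjk (hjk.trans hkl) (dn x j) a := by
  have hij' : i ≠ j := ne_of_lt hij
  have hki : k ≠ i := (ne_of_lt (hij.trans hjk)).symm
  have hkj : k ≠ j := (ne_of_lt hjk).symm
  have hli : l ≠ i := (ne_of_lt (hij.trans (hjk.trans hkl))).symm
  have hlj : l ≠ j := (ne_of_lt (hjk.trans hkl)).symm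
  have hs : lay i j (eStart k l x a) = t := by
    rw [lay_eStart hki hkj hli hlj, hx]
  have hmi : eDir k l a ≠ i := by rcases eDir_eq_or (k := k) (l := l) a with h | h <;> rw [h] <;> assumption
  have hmj : eDir k l a ≠ j := by rcases eDir_eq_or (k := k) (l := l) a with h | h <;> rw [h] <;> assumption
  have hjm : j < eDir k l a := by rcases eDir_eq_or (k := k) (l := l) a with h | h <;> rw [h]; exact hjk; exact hjk.trans hkl
  have hv1 : t.val < h := ht1
  have hv2 : (t - 1).val < h := ht2
  have hne : t ≠ 0 := ht0
  set s := eStart k l x a with hsdef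
  set m := eDir k l a with hmdef
  rw [link_sq] at hqa
  obtain ⟨y, ⟨⟨a', b'⟩, hab⟩⟩ := q
  rcases (hasLink_iff' _ s m).1 hqa with ⟨hma, hy⟩ | ⟨hmb, hy⟩
  · -- `m` is the first direction: the second direction `b' > m` is transverse
    simp only at hma hy
    subst hma
    have hbi : b' ≠ i := fun h => by rw [h] at hab; exact lt_asymm hab ((hij.trans hjm))
    have hbj : b' ≠ j := fun h => by rw [h] at hab; exact lt_asymm hab hjm
    exfalso
    refine not_mem_restPlaqs_of_layers (fun e => ?_) ?_ hq
    · have hy' : lay i j y = t := by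
        rcases hy with rfl | rfl
        · exact hs
        · rw [lay_dn_of_ne _ hbi hbj, hs]
      fin_cases e <;> simp only [vert] <;>
        [rw [hy']; rw [lay_shift_of_ne _ hmi hmj, hy'];
          rw [lay_shift_of_ne _ hbi hbj, hy'];
          rw [lay_shift_of_ne _ hbi hbj, lay_shift_of_ne _ hmi hmj, hy']] <;> exact hv1
    · refine ⟨0, ?_⟩
      show lay i j y ≠ 0
      rcases hy with rfl | rfl
      · rw [hs]; exact hne
      · rw [lay_dn_of_ne _ hbi hbj, hs]; exact hne
  · -- `m` is the second direction; the first direction `a' < m` is `i`, `j` or transverse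
    simp only at hmb hy
    subst hmb
    by_cases hai : a' = i
    · subst a'
      rcases hy with rfl | rfl
      · exact Or.inl rfl
      · exfalso
        refine not_mem_restPlaqs_of_layers (fun e => ?_) ?_ hq
        · fin_cases e <;> simp only [vert]
          · rw [lay_dn_i hij', hs]; exact hv2
          · rw [dn_shift, hs]; exact hv1
          · rw [lay_shift_of_ne _ hmi hmj, lay_dn_i hij', hs]; exact hv2
          · rw [dn_shift, lay_shift_of_ne _ hmi hmj, hs]; exact hv1
        · refine ⟨1, ?_⟩
          show lay i j ((dn s i).shift i) ≠ 0
          rw [dn_shift, hs]; exact hne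
    · by_cases haj : a' = j
      · subst a'
        rcases hy with rfl | rfl
        · exfalso
          refine not_mem_restPlaqs_of_layers (fun e => ?_) ?_ hq
          · fin_cases e <;> simp only [vert]
            · rw [hs]; exact hv1
            · rw [lay_shift_j hij', hs]; exact hv2
            · rw [lay_shift_of_ne _ hmi hmj, hs]; exact hv1
            · rw [lay_shift_of_ne _ hmi hmj, lay_shift_j hij', hs]; exact hv2
          · exact ⟨0, by show lay i j s ≠ 0; rw [hs]; exact hne⟩
        · right
          show ((dn s j, ⟨(j, m), hab⟩) : Plaquette d L) = ring hjk (hjk.trans hkl) (dn x j) a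
          unfold ring
          rw [eStart_dn]
      · have hai' : a' ≠ i := hai
        have haj' : a' ≠ j := haj
        exfalso
        refine not_mem_restPlaqs_of_layers (fun e => ?_) ?_ hq
        · have hy' : lay i j y = t := by
            rcases hy with rfl | rfl
            · exact hs
            · rw [lay_dn_of_ne _ hai' haj', hs]
          fin_cases e <;> simp only [vert] <;>
            [rw [hy']; rw [lay_shift_of_ne _ hai' haj', hy'];
              rw [lay_shift_of_ne _ hmi hmj, hy'];
              rw [lay_shift_of_ne _ hmi hmj, lay_shift_of_ne _ hai' haj', hy']] <;> exact hv1
        · refine ⟨0, ?_⟩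
          show lay i j y ≠ 0
          rcases hy with rfl | rfl
          · rw [hs]; exact hne
          · rw [lay_dn_of_ne _ hai' haj', hs]; exact hne

/-- **Generic high cover lemma.** For `sq k l z` on the layer `δ(z) = -t` (`t`, `t - 1` in the
half, `t ≠ 0`) the rest plaquettes containing its edge `a` are among `ring i (z - e_i) a` and
`ring j z a`. -/
theorem cover_high_gen {t : ZMod L} (ht1 : t.val < h) (ht2 : (t - 1).val < h) (ht0 : t ≠ 0)
    {z : Site d L} (hz : lay i j z = -t) {a : Fin 4}
    {q : Plaquette d L} (hq : q ∈ restPlaqs i j h) (hqa : HasLink q (link (sq k l hkl z) a)) :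
    q = ring (hij.trans hjk) (hij.trans (hjk.trans hkl)) (dn z i) a ∨
      q = ring hjk (hjk.trans hkl) z a := by
  have hij' : i ≠ j := ne_of_lt hij
  have hki : k ≠ i := (ne_of_lt (hij.trans hjk)).symm
  have hkj : k ≠ j := (ne_of_lt hjk).symm
  have hli : l ≠ i := (ne_of_lt (hij.trans (hjk.trans hkl))).symm
  have hlj : l ≠ j := (ne_of_lt (hjk.trans hkl)).symm
  have hs : lay i j (eStart k l z a) = -t := by
    rw [lay_eStart hki hkj hli hlj, hz]
  have hmi : eDir k l a ≠ i := by rcases eDir_eq_or (k := k) (l := l) a with h | h <;> rw [h] <;> assumption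
  have hmj : eDir k l a ≠ j := by rcases eDir_eq_or (k := k) (l := l) a with h | h <;> rw [h] <;> assumption
  have hjm : j < eDir k l a := by rcases eDir_eq_or (k := k) (l := l) a with h | h <;> rw [h]; exact hjk; exact hjk.trans hkl
  have hv1 : (-(-t)).val < h := by rw [neg_neg]; exact ht1
  have hv2 : (-(-t + 1)).val < h := by rw [show -(-t + 1) = t - 1 by ring]; exact ht2
  have hne : -t ≠ 0 := neg_ne_zero.2 ht0
  set s := eStart k l z a with hsdef
  set m := eDir k l a with hmdef
  rw [link_sq] at hqa
  obtain ⟨y, ⟨⟨a', b'⟩, hab⟩⟩ := q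
  rcases (hasLink_iff' _ s m).1 hqa with ⟨hma, hy⟩ | ⟨hmb, hy⟩
  · simp only at hma hy
    subst hma
    have hbi : b' ≠ i := fun h => by rw [h] at hab; exact lt_asymm hab ((hij.trans hjm))
    have hbj : b' ≠ j := fun h => by rw [h] at hab; exact lt_asymm hab hjm
    exfalso
    have hy' : lay i j y = -t := by
      rcases hy with rfl | rfl
      · exact hs
      · rw [lay_dn_of_ne _ hbi hbj, hs]
    refine not_mem_restPlaqs_of_neg_layers (fun e => ?_) ⟨0, by show lay i j y ≠ 0; rw [hy']; exact hne⟩ hq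
    fin_cases e <;> simp only [vert] <;>
      [rw [hy']; rw [lay_shift_of_ne _ hmi hmj, hy'];
        rw [lay_shift_of_ne _ hbi hbj, hy'];
        rw [lay_shift_of_ne _ hbi hbj, lay_shift_of_ne _ hmi hmj, hy']] <;> exact hv1
  · simp only at hmb hy
    subst hmb
    by_cases hai : a' = i
    · subst a'
      rcases hy with rfl | rfl
      · exfalso
        refine not_mem_restPlaqs_of_neg_layers (fun e => ?_) ⟨0, by show lay i j s ≠ 0; rw [hs]; exact hne⟩ hq
        fin_cases e <;> simp only [vert]
        · rw [hs]; exact hv1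
        · rw [lay_shift_i hij', hs]; exact hv2
        · rw [lay_shift_of_ne _ hmi hmj, hs]; exact hv1
        · rw [lay_shift_of_ne _ hmi hmj, lay_shift_i hij', hs]; exact hv2
      · left
        show ((dn s i, ⟨(i, m), hab⟩) : Plaquette d L) = ring (hij.trans hjk) (hij.trans (hjk.trans hkl)) (dn z i) a
        unfold ring
        rw [eStart_dn]
    · by_cases haj : a' = j
      · subst a'
        rcases hy with rfl | rfl
        · exact Or.inr rfl
        · exfalso
          refine not_mem_restPlaqs_of_neg_layers (fun e => ?_)
            ⟨1, by show lay i j ((dn s j).shift j) ≠ 0; rw [dn_shift, hs]; exact hne⟩ hq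
          fin_cases e <;> simp only [vert]
          · rw [lay_dn_j hij', hs]; exact hv2
          · rw [dn_shift, hs]; exact hv1
          · rw [lay_shift_of_ne _ hmi hmj, lay_dn_j hij', hs]; exact hv2
          · rw [dn_shift, lay_shift_of_ne _ hmi hmj, hs]; exact hv1
      · have hai' : a' ≠ i := hai
        have haj' : a' ≠ j := haj
        exfalso
        have hy' : lay i j y = -t := by
          rcases hy with rfl | rfl
          · exact hs
          · rw [lay_dn_of_ne _ hai' haj', hs]
        refine not_mem_restPlaqs_of_neg_layers (fun e => ?_) ⟨0, by show lay i j y ≠ 0; rw [hy']; exact hne⟩ hq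
        fin_cases e <;> simp only [vert] <;>
          [rw [hy']; rw [lay_shift_of_ne _ hai' haj', hy'];
            rw [lay_shift_of_ne _ hmi hmj, hy'];
            rw [lay_shift_of_ne _ hmi hmj, lay_shift_of_ne _ hai' haj', hy']] <;> exact hv1


end Cover

/-! ## The odd torus `L = 2c + 1`: casts and ring membership -/

section Odd

variable {i j k l : Fin d} (hij : i < j) (hjk : j < k) (hkl : k < l) {c : ℕ}

/-- `c` is in the closed half `δ.val < c + 1`. -/
theorem val_c_lt_odd (hL : L = 2 * c + 1) : ((c : ℕ) : ZMod L).val < c + 1 := by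
  rw [val_cast (by omega)]; exact Nat.lt_succ_self c

/-- `c - 1` is in the closed half. -/
theorem val_pred_lt_odd (hc : 1 ≤ c) (hL : L = 2 * c + 1) : (((c : ℕ) : ZMod L) - 1).val < c + 1 := by
  have : ((c : ℕ) : ZMod L) - 1 = ((c - 1 : ℕ) : ZMod L) := by
    rw [Nat.cast_sub hc, Nat.cast_one]
  rw [this, val_cast (by omega)]; omega

/-- `c ≠ 0` in `ℤ/(2c+1)`. -/
theorem cast_c_ne_zero_odd (hc : 1 ≤ c) (hL : L = 2 * c + 1) : ((c : ℕ) : ZMod L) ≠ 0 := by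
  intro h0
  have := congrArg ZMod.val h0
  rw [val_cast (by omega), ZMod.val_zero] at this
  omega

/-- `-(c) = c + 1` in `ℤ/(2c+1)`. -/
theorem neg_cast_c_odd (hL : L = 2 * c + 1) : -((c : ℕ) : ZMod L) = ((c + 1 : ℕ) : ZMod L) := by
  have h2 : ((2 * c + 1 : ℕ) : ZMod L) = 0 := by rw [← hL]; exact ZMod.natCast_self L
  push_cast at h2 ⊢
  linear_combination -h2

/-- `c + 1` is not in the closed half. -/
theorem not_val_succ_lt_odd (hc : 1 ≤ c) (hL : L = 2 * c + 1) : ¬ ((c + 1 : ℕ) : ZMod L).val < c + 1 := by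
  rw [val_cast (by omega)]; exact lt_irrefl _

/-- `-(c + 1) = c` in `ℤ/(2c+1)`. -/
theorem neg_cast_succ_odd (hL : L = 2 * c + 1) : -((c + 1 : ℕ) : ZMod L) = ((c : ℕ) : ZMod L) := by
  rw [← neg_cast_c_odd hL, neg_neg]

variable (hc : 1 ≤ c) (hL : L = 2 * c + 1) [NeZero L]

include hc hL in
/-- A plaquette with a vertex on the layer `c + 1` and a vertex on the layer `c` is a rest
plaquette of the closed half of the odd torus. -/
theorem mem_restPlaqs_odd {q : Plaquette d L} (a b : Fin 4)
    (ha : lay i j (vert q a) = ((c + 1 : ℕ) : ZMod L)) (hb : lay i j (vert q b) = ((c : ℕ) : ZMod L)) :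
    q ∈ restPlaqs i j (c + 1) :=
  mem_restPlaqs_of_verts a b (by rw [ha]; exact not_val_succ_lt_odd hc hL)
    (by rw [hb, neg_cast_c_odd hL]; exact not_val_succ_lt_odd hc hL)

include hij hjk hkl hc hL

/-- The `+e_i` ring faces over a square on the layer `c` lie in the rest. -/
theorem ring_low_i_mem_odd {x : Site d L} (hx : lay i j x = ((c : ℕ) : ZMod L)) (a : Fin 4) :
    ring (hij.trans hjk) (hij.trans (hjk.trans hkl)) x a ∈ restPlaqs i j (c + 1) := by
  have hij' : i ≠ j := ne_of_lt hij
  have hS := lay_eStart (L := L) (ne_of_lt (hij.trans hjk)).symm (ne_of_lt hjk).symm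
    (ne_of_lt (hij.trans (hjk.trans hkl))).symm (ne_of_lt (hjk.trans hkl)).symm x a (i := i) (j := j)
  refine mem_restPlaqs_odd hc hL 1 0 ?_ ?_
  · show lay i j ((eStart k l x a).shift i) = _
    rw [lay_shift_i hij', hS, hx]; push_cast; ring
  · show lay i j (eStart k l x a) = _
    rw [hS, hx]

/-- The `-e_j` ring faces below a square on the layer `c` lie in the rest. -/
theorem ring_low_j_mem_odd {x : Site d L} (hx : lay i j x = ((c : ℕ) : ZMod L)) (a : Fin 4) :
    ring hjk (hjk.trans hkl) (dn x j) a ∈ restPlaqs i j (c + 1) := by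
  have hij' : i ≠ j := ne_of_lt hij
  have hS := lay_eStart (L := L) (ne_of_lt (hij.trans hjk)).symm (ne_of_lt hjk).symm
    (ne_of_lt (hij.trans (hjk.trans hkl))).symm (ne_of_lt (hjk.trans hkl)).symm x a (i := i) (j := j)
  refine mem_restPlaqs_odd hc hL 0 1 ?_ ?_
  · show lay i j (eStart k l (dn x j) a) = _
    rw [eStart_dn, lay_dn_j hij', hS, hx]; push_cast; ring
  · show lay i j ((eStart k l (dn x j) a).shift j) = _
    rw [eStart_dn, dn_shift, hS, hx]

/-- The `-e_i` ring faces below a square on the layer `-c` lie in the rest. -/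
theorem ring_high_i_mem_odd {z : Site d L} (hz : lay i j z = -((c : ℕ) : ZMod L)) (a : Fin 4) :
    ring (hij.trans hjk) (hij.trans (hjk.trans hkl)) (dn z i) a ∈ restPlaqs i j (c + 1) := by
  have hij' : i ≠ j := ne_of_lt hij
  have hS := lay_eStart (L := L) (ne_of_lt (hij.trans hjk)).symm (ne_of_lt hjk).symm
    (ne_of_lt (hij.trans (hjk.trans hkl))).symm (ne_of_lt (hjk.trans hkl)).symm z a (i := i) (j := j)
  refine mem_restPlaqs_odd hc hL 1 0 ?_ ?_
  · show lay i j ((eStart k l (dn z i) a).shift i) = _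
    rw [eStart_dn, dn_shift, hS, hz, neg_cast_c_odd hL]
  · show lay i j (eStart k l (dn z i) a) = _
    rw [eStart_dn, lay_dn_i hij', hS, hz, neg_cast_c_odd hL]; push_cast; ring

/-- The `+e_j` ring faces over a square on the layer `-c` lie in the rest. -/
theorem ring_high_j_mem_odd {z : Site d L} (hz : lay i j z = -((c : ℕ) : ZMod L)) (a : Fin 4) :
    ring hjk (hjk.trans hkl) z a ∈ restPlaqs i j (c + 1) := by
  have hij' : i ≠ j := ne_of_lt hij
  have hS := lay_eStart (L := L) (ne_of_lt (hij.trans hjk)).symm (ne_of_lt hjk).symm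
    (ne_of_lt (hij.trans (hjk.trans hkl))).symm (ne_of_lt (hjk.trans hkl)).symm z a (i := i) (j := j)
  refine mem_restPlaqs_odd hc hL 0 1 ?_ ?_
  · show lay i j (eStart k l z a) = _
    rw [hS, hz, neg_cast_c_odd hL]
  · show lay i j ((eStart k l z a).shift j) = _
    rw [lay_shift_j hij', hS, hz, neg_cast_c_odd hL]; push_cast; ring

/-- **Odd low cover**: on the layer `c` of the odd torus. -/
theorem cover_low_odd {x : Site d L} (hx : lay i j x = ((c : ℕ) : ZMod L)) {a : Fin 4}
    {q : Plaquette d L} (hq : q ∈ restPlaqs i j (c + 1)) (hqa : HasLink q (link (sq k l hkl x) a)) :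
    q = ring (hij.trans hjk) (hij.trans (hjk.trans hkl)) x a ∨ q = ring hjk (hjk.trans hkl) (dn x j) a :=
  cover_low_gen hij hjk hkl (val_c_lt_odd hL) (val_pred_lt_odd hc hL) (cast_c_ne_zero_odd hc hL) hx hq hqa

/-- **Odd high cover**: on the layer `-c = c + 1` of the odd torus. -/
theorem cover_high_odd {z : Site d L} (hz : lay i j z = -((c : ℕ) : ZMod L)) {a : Fin 4}
    {q : Plaquette d L} (hq : q ∈ restPlaqs i j (c + 1)) (hqa : HasLink q (link (sq k l hkl z) a)) :
    q = ring (hij.trans hjk) (hij.trans (hjk.trans hkl)) (dn z i) a ∨ q = ring hjk (hjk.trans hkl) z a :=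
  cover_high_gen hij hjk hkl (val_c_lt_odd hL) (val_pred_lt_odd hc hL) (cast_c_ne_zero_odd hc hL) hz hq hqa

end Odd

end DiagRPTube

end Summit.QuantumFields.GaugeBoot
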